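import Summits.QuantumFields.BalabanUV.Beta.RootedJetLinear
import Summits.QuantumFields.BalabanUV.Beta.ReversedChartCalculus

/-!
# `BalabanUV.Beta.RootedJetReflectionExpanded` — THE REFLECTED CHART DATA READ THROUGH THE SIGNED PULL-BACK `R1g`:
# `Ad`-EXPANSION OF THE REFLECTED FLUCTUATION LETTER AND `τ₁τ₂`-TWIST SPLITTING OF THE REFLECTED BACKGROUND
# (β sub-cell, row D1 letter chain HR-W-LET, an1's list «NOT in AN1-28B (next)» item 2; an3 gen 33, an1 first refusal)

HONEST FRAMING (cell charter, verbatim): «discharging BetaPertH makes Bałaban's UV stability UNCONDITIONAL — a real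
constructive-QFT result; it is NOT the continuum limit and NOT the Clay problem.»  HONEST DEPENDENCY (verbatim): «continuum YM on
T⁴ ⇐ BetaPertH ∧ nine spine estimates (0/9 proved); BetaPertH ⇐ (D1) ∧ (D4) ∧ CAP+tail; G-an2-4 gates asym, D1 and NE2/3/4.»
DERIVED cell leaf: [folklore] ring algebra over `RootedJetReflection` (`omegaR`, `reflPair` of the chart letters), `RootedJetLinear`
(additivity ∕ centrality of `QjetLAt`), an1's M1 `RootedHolonomyReflection{,Hol}` (`R1g`, `reflPair`) and leaf-05's CUT
`ReversedChartCalculus` (p221550: `conj_reversed_expand`), all BY NAME.  No statement of Bałaban's papers is typed here, no `[cite:]`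
tag, no `Prop` is minted, no binder of the β-function wall is instantiated or discharged.  NOT summit progress.

## What this module proves

With `b := R1g α B`, `c := R1g α B′`, `w := R1g α ω` (the signed pull-backs; `b_α(x) = −B_α(x′)`, `x′ = bref α α x`):
* §1 THE REFLECTED BACKGROUND PAIR IS THE ORDERED CHART OF THE REFLECTED BACKGROUNDS UP TO A `τ₁τ₂`-TWIST ON THE AXIS:
  `reflPair α (Ebg B B′) (Ebi B B′) = (Ebg b c) · (1 + τ₁τ₂ ι dR)` and `reflPair α (Ebi B B′) (Ebg B B′) = (1 − τ₁τ₂ ι dR) · (Ebi b c)`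
  with the AXIS COMMUTATOR `dR α B B′ := 𝟙_{κ = α} (c b − b c)` (`reflPair_Ebg_Ebi`, `reflPair_Ebi_Ebg`; `dR` is ODD under `B ↔ B′`).
* §2 THE REFLECTED FLUCTUATION LETTER EXPANDS BY COMPONENTS: `omegaR α ω B B′ = w + τ₁·ad1R + τ₂·ad2R + τ₁τ₂·ad12R` with the axis
  commutators `ad1R = 𝟙_{κ=α} [ιb, w]`, `ad2R = 𝟙_{κ=α} [ιc, w]`, `ad12R = 𝟙_{κ=α} [ιc, [ιb, w]]` (`omegaR_eq`).
* §3 HENCE THE REFLECTED JET EXPANDS (additivity + centrality of `RootedJetLinear`): for ANY background letter pair `(E, Ē)`,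
  `QjetLAt ρ (omegaR α ω B B′) E Ē = QjetLAt ρ w E Ē + τ₁ · QjetLAt ρ ad1R E Ē + τ₂ · QjetLAt ρ ad2R E Ē + τ₁τ₂ · QjetLAt ρ ad12R E Ē`
  (`QjetLAt_omegaR`), and its `τ₁τ₂`-component is `c11 (… w …) + c01 (… ad1R …) + c10 (… ad2R …) + c00 (… ad12R …)` (`c11_QjetLAt_omegaR`).

## What is NOT here
The effect of the twist pair `(E·(1 + τ₁τ₂ιδ), (1 − τ₁τ₂ιδ)·Ē)` on the jet (next module), the assembly of the `T₂` reflection law,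
tables, packing.
-/

namespace Summit.QuantumFields.BalabanUV.Beta.RootedJetReflectionExpanded

open Literature.MathematicalPhysics.QuantumFieldTheory.Balaban1983to89
open Literature.MathematicalPhysics.QuantumFieldTheory.Balaban1983to89.Beta
open AffineAveraging (Form1)
open AveragingThirdJet (Tau Ebg Ebi)
open AveragingThirdJet.Tau (τ₁ τ₂ τ12 ι c00 c10 c01 c11 ext4 c11_add c11_τ₁_mul c11_τ₂_mul c11_τ12_mul)
open ResolventReflection (sref bref)
open Summit.QuantumFields.BalabanUV.Beta.RootedHolonomyReflection (R1g R1g_of_ne)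
open Summit.QuantumFields.BalabanUV.Beta.RootedHolonomyReflectionHol (reflPair reflPair_of_ne reflPair_self)
open Summit.QuantumFields.BalabanUV.Beta.RootedJetReflection (QjetLAt omegaR omegaR_of_ne omegaR_self)
open Summit.QuantumFields.BalabanUV.Beta.RootedJetLinear (QjetLAt_add QjetLAt_τ₁_mul QjetLAt_τ₂_mul QjetLAt_τ12_mul)
open Summit.QuantumFields.BalabanUV.Beta.ReversedChartCalculus (conj_reversed_expand)

variable {d : ℕ} {𝔸 : Type*} [Ring 𝔸]

/-! ## §1 The reflected background pair through `R1g` -/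

/-- [folklore] On the axis the signed pull-back is MINUS the value at the `bref`-partner (M1's `R1g_self` without rewriting `bref`). -/
theorem R1g_self_bref (α : Fin d) {R : Type*} [AddCommGroup R] (A : Form1 d R) (x : Fin d → ℤ) :
    R1g α A α x = -A α (bref α α x) := by
  rw [R1g, if_pos rfl]

/-- [folklore] `ι (−a) = −ι a`. -/
@[simp] theorem ι_neg (a : 𝔸) : (ι (-a) : Tau 𝔸) = -ι a := ext4 (by simp) (by simp) (by simp) (by simp)

/-- [folklore] The inverse background letter at the `bref`-partner of an axis bond, in the reflected backgrounds:
`Ebi B B′ α x′ = (1 + τ₂ ι c_α(x)) (1 + τ₁ ι b_α(x))` — the REVERSED two-parameter letter. -/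
theorem Ebi_bref (α : Fin d) (B B' : Form1 d 𝔸) (x : Fin d → ℤ) :
    Ebi B B' α (bref α α x) = (1 + τ₂ * ι (R1g α B' α x)) * (1 + τ₁ * ι (R1g α B α x)) := by
  rw [Ebi, R1g_self_bref, R1g_self_bref, ι_neg, ι_neg, mul_neg, mul_neg, ← sub_eq_add_neg, ← sub_eq_add_neg]

/-- [folklore] … and `Ebg B B′ α x′ = (1 − τ₁ ι b_α(x)) (1 − τ₂ ι c_α(x))`. -/
theorem Ebg_bref (α : Fin d) (B B' : Form1 d 𝔸) (x : Fin d → ℤ) :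
    Ebg B B' α (bref α α x) = (1 - τ₁ * ι (R1g α B α x)) * (1 - τ₂ * ι (R1g α B' α x)) := by
  rw [Ebg, R1g_self_bref, R1g_self_bref, ι_neg, ι_neg, mul_neg, mul_neg, sub_neg_eq_add, sub_neg_eq_add]

/-- [folklore] THE AXIS COMMUTATOR of the reflected backgrounds: `dR_κ(x) = c_κ(x) b_κ(x) − b_κ(x) c_κ(x)` on the axis `κ = α`, `0` off it. -/
def dR (α : Fin d) (B B' : Form1 d 𝔸) : Form1 d 𝔸 := fun κ x =>
  if κ = α then R1g α B' κ x * R1g α B κ x - R1g α B κ x * R1g α B' κ x else 0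

/-- [folklore] Off the axis `dR = 0`. -/
theorem dR_of_ne {α κ : Fin d} (h : κ ≠ α) (B B' : Form1 d 𝔸) (x : Fin d → ℤ) : dR α B B' κ x = 0 := by
  rw [dR, if_neg h]

/-- [folklore] On the axis `dR = c b − b c`. -/
theorem dR_self (α : Fin d) (B B' : Form1 d 𝔸) (x : Fin d → ℤ) :
    dR α B B' α x = R1g α B' α x * R1g α B α x - R1g α B α x * R1g α B' α x := by
  rw [dR, if_pos rfl]

/-- [folklore] `dR` is ODD under the exchange of the two backgrounds. -/
theorem dR_swap (α : Fin d) (B B' : Form1 d 𝔸) : dR α B' B = -dR α B B' := by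
  funext κ x
  by_cases h : κ = α
  · subst h; rw [Pi.neg_apply, Pi.neg_apply, dR_self, dR_self, neg_sub]
  · rw [Pi.neg_apply, Pi.neg_apply, dR_of_ne h, dR_of_ne h, neg_zero]

/-- [folklore] **THE REFLECTED FORWARD BACKGROUND = ORDERED CHART OF THE REFLECTED BACKGROUNDS × AXIS TWIST**:
`reflPair α (Ebg B B′) (Ebi B B′) = (Ebg b c) · (1 + τ₁τ₂ ι dR)` pointwise. -/
theorem reflPair_Ebg_Ebi (α : Fin d) (B B' : Form1 d 𝔸) :
    reflPair α (Ebg B B') (Ebi B B') = fun κ x => Ebg (R1g α B) (R1g α B') κ x * (1 + τ12 * ι (dR α B B' κ x)) := by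
  funext κ x
  by_cases h : κ = α
  · subst h
    rw [reflPair_self, Ebi_bref, dR_self, Ebg]
    exact ext4 (by simp) (by simp) (by simp) (by simp [mul_add, add_mul, mul_sub])
  · rw [reflPair_of_ne h, dR_of_ne h, Ebg, Ebg, R1g_of_ne h, R1g_of_ne h]
    exact ext4 (by simp) (by simp) (by simp) (by simp)

/-- [folklore] **THE REFLECTED BACKWARD BACKGROUND**: `reflPair α (Ebi B B′) (Ebg B B′) = (1 − τ₁τ₂ ι dR) · (Ebi b c)` pointwise. -/
theorem reflPair_Ebi_Ebg (α : Fin d) (B B' : Form1 d 𝔸) :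
    reflPair α (Ebi B B') (Ebg B B') = fun κ x => (1 - τ12 * ι (dR α B B' κ x)) * Ebi (R1g α B) (R1g α B') κ x := by
  funext κ x
  by_cases h : κ = α
  · subst h
    rw [reflPair_self, Ebg_bref, dR_self, Ebi]
    exact ext4 (by simp) (by simp) (by simp) (by simp [mul_sub, sub_mul])
  · rw [reflPair_of_ne h, dR_of_ne h, Ebi, Ebi, R1g_of_ne h, R1g_of_ne h]
    exact ext4 (by simp) (by simp) (by simp) (by simp)

/-! ## §2 The reflected fluctuation letter by components -/

/-- [folklore] AXIS COMMUTATOR with the first reflected background: `ad1R = 𝟙_{κ=α} (ι b · w − w · ι b)`. -/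
def ad1R (α : Fin d) (ω : Form1 d (Tau 𝔸)) (B : Form1 d 𝔸) : Form1 d (Tau 𝔸) := fun κ x =>
  if κ = α then ι (R1g α B κ x) * R1g α ω κ x - R1g α ω κ x * ι (R1g α B κ x) else 0

/-- [folklore] ITERATED AXIS COMMUTATOR: `ad12R = 𝟙_{κ=α} (ι c · [ι b, w] − [ι b, w] · ι c)`. -/
def ad12R (α : Fin d) (ω : Form1 d (Tau 𝔸)) (B B' : Form1 d 𝔸) : Form1 d (Tau 𝔸) := fun κ x =>
  if κ = α then ι (R1g α B' κ x) * (ι (R1g α B κ x) * R1g α ω κ x - R1g α ω κ x * ι (R1g α B κ x))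
    - (ι (R1g α B κ x) * R1g α ω κ x - R1g α ω κ x * ι (R1g α B κ x)) * ι (R1g α B' κ x) else 0

/-- [folklore] Off the axis the commutator letters vanish. -/
theorem ad1R_of_ne {α κ : Fin d} (h : κ ≠ α) (ω : Form1 d (Tau 𝔸)) (B : Form1 d 𝔸) (x : Fin d → ℤ) :
    ad1R α ω B κ x = 0 := by rw [ad1R, if_neg h]

/-- [folklore] -/
theorem ad12R_of_ne {α κ : Fin d} (h : κ ≠ α) (ω : Form1 d (Tau 𝔸)) (B B' : Form1 d 𝔸) (x : Fin d → ℤ) :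
    ad12R α ω B B' κ x = 0 := by rw [ad12R, if_neg h]

/-- [folklore] On the axis. -/
theorem ad1R_self (α : Fin d) (ω : Form1 d (Tau 𝔸)) (B : Form1 d 𝔸) (x : Fin d → ℤ) :
    ad1R α ω B α x = ι (R1g α B α x) * R1g α ω α x - R1g α ω α x * ι (R1g α B α x) := by rw [ad1R, if_pos rfl]

/-- [folklore] -/
theorem ad12R_self (α : Fin d) (ω : Form1 d (Tau 𝔸)) (B B' : Form1 d 𝔸) (x : Fin d → ℤ) :
    ad12R α ω B B' α x = ι (R1g α B' α x) * (ι (R1g α B α x) * R1g α ω α x - R1g α ω α x * ι (R1g α B α x))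
      - (ι (R1g α B α x) * R1g α ω α x - R1g α ω α x * ι (R1g α B α x)) * ι (R1g α B' α x) := by
  rw [ad12R, if_pos rfl]

/-- [folklore] No fluctuation, no commutator. -/
@[simp] theorem ad1R_zero (α : Fin d) (B : Form1 d 𝔸) : ad1R α (0 : Form1 d (Tau 𝔸)) B = 0 := by
  funext κ x; by_cases h : κ = α <;> simp [ad1R, R1g, h]

/-- [folklore] -/
@[simp] theorem ad12R_zero (α : Fin d) (B B' : Form1 d 𝔸) : ad12R α (0 : Form1 d (Tau 𝔸)) B B' = 0 := by
  funext κ x; by_cases h : κ = α <;> simp [ad12R, R1g, h]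

/-- [folklore] **THE REFLECTED FLUCTUATION LETTER BY COMPONENTS** (leaf-05's `conj_reversed_expand` at the axis bond):
`omegaR α ω B B′ = w + τ₁ · ad1R(b) + τ₂ · ad1R(c) + τ₁τ₂ · ad12R(b, c)`, `w = R1g α ω`. -/
theorem omegaR_eq (α : Fin d) (ω : Form1 d (Tau 𝔸)) (B B' : Form1 d 𝔸) :
    omegaR α ω B B' = R1g α ω + (fun κ x => τ₁ * ad1R α ω B κ x) + (fun κ x => τ₂ * ad1R α ω B' κ x)
      + (fun κ x => τ12 * ad12R α ω B B' κ x) := by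
  funext κ x
  simp only [Pi.add_apply]
  by_cases h : κ = α
  · subst h
    rw [omegaR_self, Ebi_bref, Ebg_bref, ad1R_self, ad1R_self, ad12R_self, ← conj_reversed_expand, mul_assoc]
  · rw [omegaR_of_ne h, ad1R_of_ne h, ad1R_of_ne h, ad12R_of_ne h, mul_zero, mul_zero, mul_zero, add_zero, add_zero, add_zero]

/-! ## §3 The reflected jet by components -/

variable (𝕜 : Type*) [Field 𝕜] [Algebra 𝕜 𝔸]

/-- [folklore] **THE `Ad`-EXPANSION OF THE REFLECTED JET** (any background letter pair `(E, Ē)`, any root):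
`Q(ω♯) = Q(w) + τ₁ Q(ad1R b) + τ₂ Q(ad1R c) + τ₁τ₂ Q(ad12R)`. -/
theorem QjetLAt_omegaR (ρ : Fin d → ℤ) (α : Fin d) (ω : Form1 d (Tau 𝔸)) (B B' : Form1 d 𝔸) (E Eb : Form1 d (Tau 𝔸)) (L : ℕ)
    (μ : Fin d) (y : Fin d → ℤ) :
    QjetLAt 𝕜 ρ (omegaR α ω B B') E Eb L μ y
      = QjetLAt 𝕜 ρ (R1g α ω) E Eb L μ y + τ₁ * QjetLAt 𝕜 ρ (ad1R α ω B) E Eb L μ y + τ₂ * QjetLAt 𝕜 ρ (ad1R α ω B') E Eb L μ y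
        + τ12 * QjetLAt 𝕜 ρ (ad12R α ω B B') E Eb L μ y := by
  rw [omegaR_eq, QjetLAt_add, QjetLAt_add, QjetLAt_add, QjetLAt_τ₁_mul, QjetLAt_τ₂_mul, QjetLAt_τ12_mul]

/-- [folklore] **ITS `τ₁τ₂`-COMPONENT**: `c11 Q(ω♯) = c11 Q(w) + c01 Q(ad1R b) + c10 Q(ad1R c) + c00 Q(ad12R)`. -/
theorem c11_QjetLAt_omegaR (ρ : Fin d → ℤ) (α : Fin d) (ω : Form1 d (Tau 𝔸)) (B B' : Form1 d 𝔸) (E Eb : Form1 d (Tau 𝔸))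
    (L : ℕ) (μ : Fin d) (y : Fin d → ℤ) :
    c11 (QjetLAt 𝕜 ρ (omegaR α ω B B') E Eb L μ y)
      = c11 (QjetLAt 𝕜 ρ (R1g α ω) E Eb L μ y) + c01 (QjetLAt 𝕜 ρ (ad1R α ω B) E Eb L μ y)
        + c10 (QjetLAt 𝕜 ρ (ad1R α ω B') E Eb L μ y) + c00 (QjetLAt 𝕜 ρ (ad12R α ω B B') E Eb L μ y) := by
  rw [QjetLAt_omegaR, c11_add, c11_add, c11_add, c11_τ₁_mul, c11_τ₂_mul, c11_τ12_mul]

end Summit.QuantumFields.BalabanUV.Beta.RootedJetReflectionExpanded
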